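import Summits.ResolutionOfSingularities.ResolutionOfSingularities.Theorems.FrobeniusClosingPatchingRelPerfectDepthTaylorFlag
import Literature.AlgebraicGeometry.Resolution.MarkedIdealsEtale
import Literature.AlgebraicGeometry.Resolution.BlowupChartMembership
import Summits.ResolutionOfSingularities.ResolutionOfSingularities.Theorems.FrobeniusClosingPatchingRelPerfectDepthOrderRegularDivisor
import Summits.ResolutionOfSingularities.ResolutionOfSingularities.Theorems.FrobeniusClosingPatchingRelPerfectDepthOneDictionaryStep
import HarnessLib

/-!
# Crux `PatchingRelPerfect` (stmt-ResolutionOfSingularities-16161), chain W5.2 — rung R4♭ (F6 DESIGN MEMO v0 c3041ebc,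
# §1 KEY OBSERVATION = target T6-H): THE COEFFICIENT FLAG DETECTS ORDER TWO

[OURS · L1 W5.2 · rung tool] Replaces the role of NO printed item; NOT a statement of the manuscript under review;
fact-free, coordinate-free, any scheme.  For a retraction pair `k : W ⟶ V`, `r : V ⟶ W`, `k ≫ r = 𝟙` (res-L1-w52-lead-1's
`DepthGraded.taylorShift` / `DepthGraded.coeffFlag`, …DepthTaylorFlag) and ANY ideal sheaf `J` of `V`, at a point `x ∈ W`
where `P = ker k` has order `≤ 1` (e.g. `V`, `W` regular):

* `le_idealOrder_coeffFlag_zero` — `ord_{kx} J ≤ ord_x (coeffFlag 0 J)` (orders do not decrease under pull-back);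
* `mem_support_taylorShift` — `ord_{kx} J ≥ 2 ⇒ kx ∈ V(taylorShift J)`: otherwise `P_{kx} = P_{kx}·(taylorShift J)_{kx}
  ⊆ (J ⊔ r^*(J|_W))_{kx} ⊆ 𝔪²`, contradicting `ord P ≤ 1`;
* **`idealOrder_le_one_of_flag`** — `ord_x (coeffFlag 0 J ⊔ (coeffFlag 1 J)²) ≤ 1 ⇒ ord_{kx} J ≤ 1`, and the host form
  **`idealOrder_host_le_one_of_flag`** — for `K ≤ 𝓗 ⊔ P²` (a one-form depth-two member `K = 𝓗 ⊔ 𝓘_E²`, or any `K`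
  between `𝓗` and `𝓗 ⊔ P²`): `ord_x (R₂ ⊔ R₁²) ≤ 1 ⇒ ord_{kx} 𝓗 ≤ 1`, i.e. the host is cut out at `kx` by a REGULAR
  PARAMETER (`not_mem_sq_of_flag`: a generator of `𝓗_{kx}` is not in `𝔪²`).
This is the KEY OBSERVATION of the F6 memo (§1; q7: no falsifier) WITHOUT Taylor coordinates, integrality or Cartier
hypotheses: only monotonicity of orders and `P · (L : P) ⊆ L`.  The memo's two cases (`ord f̄ = 1`: `H ⋔ E`; `ḡ` a unit:
`H` tangent to `E`) are the two ways the hypothesis can hold; the conclusion does not distinguish them.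
* CONVERSE (`P` effective Cartier, `k` a closed immersion): `two_le_idealOrder_of_flag` — `ord_x R₂ ≥ 2 ∧ x ∈ V(R₁) ⇒
  ord_{kx} J ≥ 2` (res-L1-w52-lead-1's decomposition `J ≤ r^*(J|_W) ⊔ P · taylorShift J`), i.e. clause (a) of §2.3
  «at a regular host point with `ord 𝔟 ≥ 2` the first coefficient ideal is the unit ideal (`g` a unit, `H` tangent to
  `E`)»; together **`idealOrder_le_one_iff_flag`**: END₁ at a point ⟺ the host is a regular parameter there.
* T6-H SHAPE, carrier-free (`W`, `V` regular, `ker k` effective Cartier ⇒ `ord (ker k) = 1` along `W`,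
  `idealOrder_ker_le_one` / `one_le_idealOrder_ker`): **`not_mem_sq_host_of_flag`**, **`exists_generator_host_not_mem_sq_of_flag`**
  — the by-name `hostRegularAt_of_order_le_one` over `FlagFormat` (TargetsF6) is these, read on the retraction neighbourhood.

## References
* H. Kawanoue, K. Matsuki, Adv. Stud. Pure Math. 70 (2016), §2 (idealistic filtration along a hypersurface). [KawanoueMatsuki2016]
* E. Bierstone, D. Grigoriev, P. Milman, J. Włodarczyk, arXiv:1206.3090, §3.1 (order of an ideal). [BierstoneGrigorievMilmanWlodarczyk2011]
-/

-- `Summit.<Summit>.<Sub>.Theorems` with `Sub = Summit` (single-conjunct summit, D-0017)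
set_option linter.dupNamespace false

noncomputable section

open CategoryTheory AlgebraicGeometry TopologicalSpace IsLocalRing
open Literature.AlgebraicGeometry.Resolution

namespace Summit.ResolutionOfSingularities.ResolutionOfSingularities.Theorems

universe u

namespace DepthFlag

open DepthGraded

variable {W V : Scheme.{u}} (k : W ⟶ V) (r : V ⟶ W)

/-- `ord_x(A ⊔ B) ≥ n` iff both `ord_x A ≥ n` and `ord_x B ≥ n`. [folklore] -/
theorem le_idealOrder_sup_iff {X : Scheme.{u}} (A B : X.IdealSheafData) (x : X) (n : ℕ) :
    (n : ℕ∞) ≤ idealOrder (A ⊔ B) x ↔ (n : ℕ∞) ≤ idealOrder A x ∧ (n : ℕ∞) ≤ idealOrder B x := by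
  rw [le_idealOrder_iff, le_idealOrder_iff, le_idealOrder_iff, stalkIdeal_sup, sup_le_iff]

/-- `ord_x(A²) ≥ 2` as soon as `ord_x A ≥ 1`. [folklore] -/
theorem two_le_idealOrder_sq {X : Scheme.{u}} (A : X.IdealSheafData) (x : X) (h : 1 ≤ idealOrder A x) :
    (2 : ℕ∞) ≤ idealOrder (A ^ 2) x := by
  have h1 : ((1 : ℕ) : ℕ∞) ≤ idealOrder A x := by exact_mod_cast h
  rw [le_idealOrder_iff, pow_one] at h1
  have h2 : ((2 : ℕ) : ℕ∞) ≤ idealOrder (A ^ 2) x := by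
    rw [le_idealOrder_iff, stalkIdeal_pow]
    exact Ideal.pow_right_mono h1 2
  exact_mod_cast h2

/-- In `ℕ∞`, not `≤ 1` means `≥ 2`. [folklore] -/
theorem two_le_of_not_le_one {a : ℕ∞} (h : ¬ a ≤ 1) : 2 ≤ a := by
  rw [not_le] at h
  exact Order.add_one_le_of_lt h

/-- **Orders do not decrease along the flag's zeroth term**: `ord_{kx} J ≤ ord_x (coeffFlag 0 J) = ord_x (J|_W)`.
[folklore] -/
theorem le_idealOrder_coeffFlag_zero (J : V.IdealSheafData) (x : W) :
    idealOrder J (k.base x) ≤ idealOrder (coeffFlag k r 0 J) x := by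
  rw [coeffFlag_zero]
  exact idealOrder_le_idealOrder_comap k J x

/-- **`ord_{kx} J ≥ 2` forces `kx ∈ V(taylorShift J)`** when `ord_{kx} P ≤ 1` (`P = ker k`): if the Taylor shift were
the unit ideal at `kx`, then `P_{kx} = P_{kx} · (taylorShift J)_{kx} ⊆ ((J ⊔ r^*(J|_W)) ⊓ P)_{kx} ⊆ 𝔪_{kx}²` — the
last step because `ord_{kx} r^*(J|_W) ≥ ord_{r(kx)} (J|_W) = ord_x (J|_W) ≥ ord_{kx} J ≥ 2` — contradicting `ord P ≤ 1`.
[cite: KawanoueMatsuki2016, §2] -/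
theorem mem_support_taylorShift (hkr : k ≫ r = 𝟙 W) (J : V.IdealSheafData) (x : W)
    (hJ : (2 : ℕ∞) ≤ idealOrder J (k.base x)) (hP : idealOrder k.ker (k.base x) ≤ 1) :
    k.base x ∈ (taylorShift k r J).support := by
  by_contra hx
  have htop : stalkIdeal (taylorShift k r J) (k.base x) = ⊤ := stalkIdeal_eq_top_of_not_mem_support hx
  -- `P · taylorShift J ≤ (J ⊔ r^*(J|_W)) ⊓ P ≤ J ⊔ r^*(J|_W)`
  have hmul : k.ker * taylorShift k r J ≤ J ⊔ (J.comap k).comap r :=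
    (le_colon_iff.mp le_rfl).trans inf_le_left
  -- orders at `kx`
  have hrk : r.base (k.base x) = x := by
    have h := congrArg (fun f => f.base x) hkr
    simpa using h
  have hord : ((2 : ℕ) : ℕ∞) ≤ idealOrder (J ⊔ (J.comap k).comap r) (k.base x) := by
    rw [le_idealOrder_sup_iff]
    refine ⟨by exact_mod_cast hJ, ?_⟩
    calc ((2 : ℕ) : ℕ∞) ≤ idealOrder J (k.base x) := by exact_mod_cast hJ
      _ ≤ idealOrder (J.comap k) x := idealOrder_le_idealOrder_comap k J x
      _ = idealOrder (J.comap k) (r.base (k.base x)) := by rw [hrk]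
      _ ≤ idealOrder ((J.comap k).comap r) (k.base x) := idealOrder_le_idealOrder_comap r (J.comap k) (k.base x)
  rw [le_idealOrder_iff] at hord
  have hPle : stalkIdeal k.ker (k.base x) ≤ maximalIdeal (V.presheaf.stalk (k.base x)) ^ 2 := by
    calc stalkIdeal k.ker (k.base x) = stalkIdeal (k.ker * taylorShift k r J) (k.base x) := by
          rw [stalkIdeal_mul, htop, Ideal.mul_top]
      _ ≤ stalkIdeal (J ⊔ (J.comap k).comap r) (k.base x) := stalkIdeal_mono hmul _
      _ ≤ _ := hord
  have h2 : ((2 : ℕ) : ℕ∞) ≤ idealOrder k.ker (k.base x) := (le_idealOrder_iff _ _ 2).mpr hPle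
  have h3 : ((2 : ℕ) : ℕ∞) ≤ 1 := h2.trans hP
  exact absurd h3 (by decide)

/-- **THE FLAG DETECTS ORDER TWO** (F6 KEY OBSERVATION, coordinate-free): if `ord_x (coeffFlag 0 J ⊔ (coeffFlag 1 J)²) ≤ 1`
and `ord_{kx} (ker k) ≤ 1`, then `ord_{kx} J ≤ 1`. [cite: KawanoueMatsuki2016, §2] -/
theorem idealOrder_le_one_of_flag (hkr : k ≫ r = 𝟙 W) (J : V.IdealSheafData) (x : W)
    (hP : idealOrder k.ker (k.base x) ≤ 1)
    (hflag : idealOrder (coeffFlag k r 0 J ⊔ coeffFlag k r 1 J ^ 2) x ≤ 1) :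
    idealOrder J (k.base x) ≤ 1 := by
  by_contra hJ
  have hJ2 : (2 : ℕ∞) ≤ idealOrder J (k.base x) := two_le_of_not_le_one hJ
  -- zeroth term: order ≥ 2
  have h0 : (2 : ℕ∞) ≤ idealOrder (coeffFlag k r 0 J) x := hJ2.trans (le_idealOrder_coeffFlag_zero k r J x)
  -- first term: `x ∈ V(coeffFlag 1 J)`, so its square has order ≥ 2
  have h1 : 1 ≤ idealOrder (coeffFlag k r 1 J) x := by
    rw [one_le_idealOrder_iff, coeffFlag_succ, coeffFlag_zero]
    show x ∈ (((taylorShift k r J).comap k).support : Set W)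
    rw [Scheme.IdealSheafData.support_comap]
    exact mem_support_taylorShift k r hkr J x hJ2 hP
  have h1' : (2 : ℕ∞) ≤ idealOrder (coeffFlag k r 1 J ^ 2) x := two_le_idealOrder_sq _ x h1
  have h2 : ((2 : ℕ) : ℕ∞) ≤ idealOrder (coeffFlag k r 0 J ⊔ coeffFlag k r 1 J ^ 2) x := by
    rw [le_idealOrder_sup_iff]
    exact ⟨by exact_mod_cast h0, by exact_mod_cast h1'⟩
  have h3 : ((2 : ℕ) : ℕ∞) ≤ 1 := h2.trans hflag
  exact absurd h3 (by decide)

/-- **Host form (T6-H shape)**: for a member `K` with `K ≤ 𝓗 ⊔ (ker k)²` — e.g. the one-form depth-two member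
`K = 𝓗 ⊔ 𝓘_E²` of the F6 memo, `𝓗 = (F)` its host — at a point `x` with `1 ≤ ord_{kx} (ker k) ≤ 1`:
`ord_x (coeffFlag 0 K ⊔ (coeffFlag 1 K)²) ≤ 1 ⇒ ord_{kx} 𝓗 ≤ 1`. [cite: KawanoueMatsuki2016, §2] -/
theorem idealOrder_host_le_one_of_flag (hkr : k ≫ r = 𝟙 W) {K 𝓗 : V.IdealSheafData} (hK : K ≤ 𝓗 ⊔ k.ker ^ 2)
    (x : W) (hP1 : 1 ≤ idealOrder k.ker (k.base x)) (hP : idealOrder k.ker (k.base x) ≤ 1)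
    (hflag : idealOrder (coeffFlag k r 0 K ⊔ coeffFlag k r 1 K ^ 2) x ≤ 1) :
    idealOrder 𝓗 (k.base x) ≤ 1 := by
  have hK1 : idealOrder K (k.base x) ≤ 1 := idealOrder_le_one_of_flag k r hkr K x hP hflag
  by_contra h𝓗
  have h2 : (2 : ℕ∞) ≤ idealOrder 𝓗 (k.base x) := two_le_of_not_le_one h𝓗
  have hP2 : (2 : ℕ∞) ≤ idealOrder (k.ker ^ 2) (k.base x) := two_le_idealOrder_sq _ _ hP1
  have hsup : ((2 : ℕ) : ℕ∞) ≤ idealOrder (𝓗 ⊔ k.ker ^ 2) (k.base x) := by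
    rw [le_idealOrder_sup_iff]
    exact ⟨by exact_mod_cast h2, by exact_mod_cast hP2⟩
  rw [le_idealOrder_iff] at hsup
  have hK2 : ((2 : ℕ) : ℕ∞) ≤ idealOrder K (k.base x) :=
    (le_idealOrder_iff _ _ 2).mpr ((stalkIdeal_mono hK _).trans hsup)
  have h3 : ((2 : ℕ) : ℕ∞) ≤ 1 := hK2.trans hK1
  exact absurd h3 (by decide)

/-- **Generator form**: under the same hypotheses, a generator of the (principal) stalk `𝓗_{kx}` is NOT in `𝔪_{kx}²` —
the host is cut out at `kx` by a regular parameter of `𝒪_{V,kx}` (when that ring is regular). [folklore] -/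
theorem not_mem_sq_of_flag (hkr : k ≫ r = 𝟙 W) {K 𝓗 : V.IdealSheafData} (hK : K ≤ 𝓗 ⊔ k.ker ^ 2)
    (x : W) (hP1 : 1 ≤ idealOrder k.ker (k.base x)) (hP : idealOrder k.ker (k.base x) ≤ 1)
    (hflag : idealOrder (coeffFlag k r 0 K ⊔ coeffFlag k r 1 K ^ 2) x ≤ 1)
    {F : V.presheaf.stalk (k.base x)} (hF : stalkIdeal 𝓗 (k.base x) = Ideal.span {F}) :
    F ∉ maximalIdeal (V.presheaf.stalk (k.base x)) ^ 2 := by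
  intro hF2
  have h := idealOrder_host_le_one_of_flag k r hkr hK x hP1 hP hflag
  have h2 : ((2 : ℕ) : ℕ∞) ≤ idealOrder 𝓗 (k.base x) := by
    rw [le_idealOrder_iff, hF, Ideal.span_singleton_le_iff_mem]
    exact hF2
  have h3 : ((2 : ℕ) : ℕ∞) ≤ 1 := h2.trans h
  exact absurd h3 (by decide)

/-! ## The converse: at a regular host point with `ord R₂ ≥ 2`, the first coefficient ideal is the unit ideal -/

section Converse

variable [IsClosedImmersion k]

/-- **Converse (clause (a) of the F6 memo §2.3: «`ord_z 𝔟 ≥ 2` at a regular host point ⇒ `g(z) ≠ 0`, `H` tangent to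
`E`, no pocket»)**: for `P = ker k` an effective Cartier divisor with `ord_{kx} P ≥ 1`, if `ord_x (coeffFlag 0 J) ≥ 2`
and `x ∈ V(coeffFlag 1 J)` then `ord_{kx} J ≥ 2` — by res-L1-w52-lead-1's decomposition
`J ≤ r^*(J|_W) ⊔ P · taylorShift J` (`le_comap_comap_sup_mul_taylorShift`): both summands lie in `𝔪_{kx}²`.
[cite: KawanoueMatsuki2016, §2] -/
theorem two_le_idealOrder_of_flag (hkr : k ≫ r = 𝟙 W) (hPc : IsEffectiveCartier k.ker) (J : V.IdealSheafData)
    (x : W) (hP1 : 1 ≤ idealOrder k.ker (k.base x)) (h0 : (2 : ℕ∞) ≤ idealOrder (coeffFlag k r 0 J) x)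
    (h1 : x ∈ (coeffFlag k r 1 J).support) : (2 : ℕ∞) ≤ idealOrder J (k.base x) := by
  have hrk : r.base (k.base x) = x := by
    have h := congrArg (fun f => f.base x) hkr
    simpa using h
  -- the constant term has order `≥ 2` at `kx`
  have hc : ((2 : ℕ) : ℕ∞) ≤ idealOrder ((J.comap k).comap r) (k.base x) := by
    calc ((2 : ℕ) : ℕ∞) ≤ idealOrder (coeffFlag k r 0 J) x := by exact_mod_cast h0
      _ = idealOrder (J.comap k) (r.base (k.base x)) := by rw [coeffFlag_zero, hrk]
      _ ≤ idealOrder ((J.comap k).comap r) (k.base x) := idealOrder_le_idealOrder_comap r (J.comap k) (k.base x)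
  rw [le_idealOrder_iff] at hc
  -- the shifted part `P · taylorShift J` has order `≥ 1 + 1` at `kx`
  have hx1 : k.base x ∈ (taylorShift k r J).support := by
    have h : x ∈ (((taylorShift k r J).comap k).support : Set W) := by
      rw [coeffFlag_succ, coeffFlag_zero] at h1
      exact h1
    rwa [Scheme.IdealSheafData.support_comap] at h
  have hP' : stalkIdeal k.ker (k.base x) ≤ maximalIdeal _ ^ 1 := by
    have h : ((1 : ℕ) : ℕ∞) ≤ idealOrder k.ker (k.base x) := by exact_mod_cast hP1
    exact (le_idealOrder_iff _ _ 1).mp h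
  have hT' : stalkIdeal (taylorShift k r J) (k.base x) ≤ maximalIdeal _ ^ 1 := by
    rw [pow_one]
    exact (mem_support_iff_stalkIdeal_le _ _).mp hx1
  have hmul : stalkIdeal (k.ker * taylorShift k r J) (k.base x) ≤ maximalIdeal _ ^ 2 := by
    rw [stalkIdeal_mul, show (2 : ℕ) = 1 + 1 from rfl, pow_add]
    exact Ideal.mul_mono hP' hT'
  have h2 : ((2 : ℕ) : ℕ∞) ≤ idealOrder J (k.base x) := by
    rw [le_idealOrder_iff]
    calc stalkIdeal J (k.base x)
        ≤ stalkIdeal ((J.comap k).comap r ⊔ k.ker * taylorShift k r J) (k.base x) :=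
          stalkIdeal_mono (le_comap_comap_sup_mul_taylorShift k r hkr hPc J) _
      _ ≤ maximalIdeal _ ^ 2 := by
          rw [stalkIdeal_sup, sup_le_iff]
          exact ⟨hc, hmul⟩
  exact_mod_cast h2

/-- **END₁ at a point, characterised** (F6 memo §1/§2.2): for `P = ker k` effective Cartier with `ord_{kx} P = 1`,
`ord_{kx} J ≤ 1 ↔ ord_x (coeffFlag 0 J ⊔ (coeffFlag 1 J)²) ≤ 1`. [cite: KawanoueMatsuki2016, §2] -/
theorem idealOrder_le_one_iff_flag (hkr : k ≫ r = 𝟙 W) (hPc : IsEffectiveCartier k.ker) (J : V.IdealSheafData)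
    (x : W) (hP1 : 1 ≤ idealOrder k.ker (k.base x)) (hP : idealOrder k.ker (k.base x) ≤ 1) :
    idealOrder J (k.base x) ≤ 1 ↔ idealOrder (coeffFlag k r 0 J ⊔ coeffFlag k r 1 J ^ 2) x ≤ 1 := by
  refine ⟨fun hJ => ?_, idealOrder_le_one_of_flag k r hkr J x hP⟩
  by_contra hflag
  have h2 : ((2 : ℕ) : ℕ∞) ≤ idealOrder (coeffFlag k r 0 J ⊔ coeffFlag k r 1 J ^ 2) x := by
    exact_mod_cast two_le_of_not_le_one hflag
  rw [le_idealOrder_sup_iff] at h2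
  obtain ⟨h0, h1⟩ := h2
  -- `x ∈ V(coeffFlag 1 J)`: otherwise its square would be the unit ideal at `x`, of order `0`
  have hx1 : x ∈ (coeffFlag k r 1 J).support := by
    by_contra hx
    have htop : stalkIdeal (coeffFlag k r 1 J ^ 2) x = ⊤ := by
      rw [stalkIdeal_pow, stalkIdeal_eq_top_of_not_mem_support hx, Ideal.top_pow]
    rw [le_idealOrder_iff, htop, top_le_iff] at h1
    exact (maximalIdeal.isMaximal _).ne_top
      (top_le_iff.mp (h1 ▸ Ideal.pow_le_self (by norm_num : (2 : ℕ) ≠ 0)))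
  have hJ2 := two_le_idealOrder_of_flag k r hkr hPc J x hP1 (by exact_mod_cast h0) hx1
  have h3 : (2 : ℕ∞) ≤ 1 := hJ2.trans hJ
  exact absurd h3 (by decide)

end Converse

/-! ## The host at a point of `E`, for regular `E ⊂ V` (the T6-H shape, carrier-free) -/

section HostRegular

variable [IsClosedImmersion k]

/-- `kx ∈ V(ker k)`: the kernel of a closed immersion has order `≥ 1` along the image. [folklore] -/
theorem one_le_idealOrder_ker (x : W) : 1 ≤ idealOrder k.ker (k.base x) := by
  rw [one_le_idealOrder_iff]
  have h : (k.ker.support : Set V) = closure (Set.range k.base) := by rw [Scheme.Hom.support_ker]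
  show k.base x ∈ (k.ker.support : Set V)
  rw [h]
  exact subset_closure ⟨x, rfl⟩

/-- **`ord (ker k) ≤ 1` everywhere** when `V` and `W` are regular (`V` locally Noetherian) and `ker k` is an effective
Cartier divisor: `V(ker k) ≅ W` is regular, so the local equation is a regular parameter
(`DepthTargets.idealOrder_le_one_of_isRegular_subscheme`). [cite: Matsumura1987, Thm. 14.2] -/
theorem idealOrder_ker_le_one [IsLocallyNoetherian V] (hV : Scheme.IsRegular V) (hW : Scheme.IsRegular W)
    (hPc : IsEffectiveCartier k.ker) (y : V) : idealOrder k.ker y ≤ 1 :=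
  DepthTargets.idealOrder_le_one_of_isRegular_subscheme hV hPc.isLocallyPrincipal
    (fun e => by
      obtain ⟨t, ht, he⟩ := hPc.exists_stalkIdeal_eq_span e
      rw [he, ne_eq, Ideal.span_singleton_eq_bot]
      exact nonZeroDivisors.ne_zero ht)
    (DepthOne.isRegular_subscheme_ker k hW) y

/-- **T6-H, carrier-free**: `W`, `V` regular (`V` locally Noetherian), `k : W ⟶ V` a closed immersion with retraction `r`
and `ker k` effective Cartier, `K ≤ 𝓗 ⊔ (ker k)²` (e.g. the member `K = 𝓗 ⊔ 𝓘_W²`); if the flag of `K` has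
`ord_x (coeffFlag 0 K ⊔ (coeffFlag 1 K)²) ≤ 1` then every generator of the stalk `𝓗_{kx}` is a REGULAR PARAMETER of
`𝒪_{V,kx}` (not in `𝔪²`). [cite: KawanoueMatsuki2016, §2] [cite: Matsumura1987, Thm. 14.2] -/
theorem not_mem_sq_host_of_flag [IsLocallyNoetherian V] (hV : Scheme.IsRegular V) (hW : Scheme.IsRegular W)
    (hkr : k ≫ r = 𝟙 W) (hPc : IsEffectiveCartier k.ker) {K 𝓗 : V.IdealSheafData} (hK : K ≤ 𝓗 ⊔ k.ker ^ 2)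
    (x : W) (hflag : idealOrder (coeffFlag k r 0 K ⊔ coeffFlag k r 1 K ^ 2) x ≤ 1)
    {F : V.presheaf.stalk (k.base x)} (hF : stalkIdeal 𝓗 (k.base x) = Ideal.span {F}) :
    F ∉ maximalIdeal (V.presheaf.stalk (k.base x)) ^ 2 :=
  not_mem_sq_of_flag k r hkr hK x (one_le_idealOrder_ker k x) (idealOrder_ker_le_one k hV hW hPc _) hflag hF

/-- **T6-H, carrier-free, existential form** for an effective Cartier host `𝓗`: under the same hypotheses the stalk
`𝓗_{kx}` is generated by a nonzerodivisor which is a regular parameter of `𝒪_{V,kx}`; in particular `V(𝓗)` is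
regular at `kx` (`IsRegularLocalRing` of the quotient, Matsumura Thm. 14.2). [cite: KawanoueMatsuki2016, §2]
[cite: Matsumura1987, Thm. 14.2] -/
theorem exists_generator_host_not_mem_sq_of_flag [IsLocallyNoetherian V] (hV : Scheme.IsRegular V)
    (hW : Scheme.IsRegular W) (hkr : k ≫ r = 𝟙 W) (hPc : IsEffectiveCartier k.ker) {K 𝓗 : V.IdealSheafData}
    (h𝓗 : IsEffectiveCartier 𝓗) (hK : K ≤ 𝓗 ⊔ k.ker ^ 2) (x : W)
    (hflag : idealOrder (coeffFlag k r 0 K ⊔ coeffFlag k r 1 K ^ 2) x ≤ 1) :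
    ∃ F : V.presheaf.stalk (k.base x), F ∈ nonZeroDivisors _ ∧ stalkIdeal 𝓗 (k.base x) = Ideal.span {F} ∧
      F ∉ maximalIdeal (V.presheaf.stalk (k.base x)) ^ 2 := by
  obtain ⟨F, hFnzd, hF⟩ := h𝓗.exists_stalkIdeal_eq_span (k.base x)
  exact ⟨F, hFnzd, hF, not_mem_sq_host_of_flag k r hV hW hkr hPc hK x hflag hF⟩

end HostRegular

end DepthFlag

end Summit.ResolutionOfSingularities.ResolutionOfSingularities.Theorems

end
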